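import Mathlib
import HarnessLib
import Literature.MathematicalPhysics.QuantumLattice.GaugeGroups
import Summits.Ventures.LatticeQCDFlow.Exactness.CompactHaar

/-!
# Conjugation masses `κ_A(U) = Haar{g | g U g⁻¹ ∈ A}` on a compact group: a class function, and `Haar(A) = ∫ κ_A dHaar`

HONEST FRAMING: exact (Metropolis-corrected) sampling algorithms for lattice gauge theory;
figures of merit are autocorrelation/cost numbers at stated couplings and volumes; no
continuum-physics claim.

Venture `LatticeQCDFlow` (cell pub-lqcd), topic `Exactness`; FANOUT row 10 (`eng-equiv`).  NEW
WORK of the cell over Mathlib (`Measure.prod_apply`, `measurable_measure_prodMk_left`) and row 9's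
`CompactHaar.lean` (Haar on a compact group is two-sided invariant: the instances
`haarProbability.instIsMulRightInvariant`).  Nothing is cited as a fact; no number; no definition.
The measure-theoretic half of the proof of Weyl's integral formula for `SU(2)`
(`WeylIntegralFormulaSU2.lean`): for a Borel set `A` of a compact second-countable group `G`,

* `measurable_conjPair`, `measurableSet_conjSet`, **`measurable_conjMass`** — `U ↦ κ_A(U)` is
  measurable (a section of the measurable set `{(U, g) | g U g⁻¹ ∈ A}`);
* **`conjMass_conj`** — `κ_A(h U h⁻¹) = κ_A(U)` (right invariance);
* **`haar_conjPreimage`** — `Haar{U | g U g⁻¹ ∈ A} = Haar(A)` (two-sided invariance);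
* **`haar_eq_lintegral_conjMass`** — `Haar(A) = ∫ κ_A(U) dHaar(U)` (Tonelli).

NOT here: anything specific to `SU(n)`.
-/

noncomputable section

namespace Summit.Ventures.LatticeQCDFlow.Exactness

open MeasureTheory Topology Set
open Literature.MathematicalPhysics.QuantumFieldTheory (haarProbability)
open scoped ENNReal

/-! ## Conjugation masses `κ_A(U) = Haar{g | g U g⁻¹ ∈ A}` on a compact group -/

section ConjMass

variable {G : Type*} [Group G] [TopologicalSpace G] [IsTopologicalGroup G] [CompactSpace G]
  [MeasurableSpace G] [BorelSpace G] [SecondCountableTopology G]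

omit [CompactSpace G] in
/-- `(U, g) ↦ g U g⁻¹` is measurable. -/
theorem measurable_conjPair : Measurable fun q : G × G => q.2 * q.1 * q.2⁻¹ :=
  ((continuous_snd.mul continuous_fst).mul continuous_snd.inv).measurable

omit [CompactSpace G] in
/-- The set `{(U, g) | g U g⁻¹ ∈ A}` is measurable. -/
theorem measurableSet_conjSet {A : Set G} (hA : MeasurableSet A) :
    MeasurableSet {q : G × G | q.2 * q.1 * q.2⁻¹ ∈ A} :=
  measurable_conjPair hA

/-- `U ↦ κ_A(U) = Haar{g | g U g⁻¹ ∈ A}` is measurable (the measure of a section of a measurable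
set). -/
theorem measurable_conjMass {A : Set G} (hA : MeasurableSet A) :
    Measurable fun U : G => haarProbability G {g : G | g * U * g⁻¹ ∈ A} := by
  have h : Measurable fun U : G =>
      haarProbability G (Prod.mk U ⁻¹' {q : G × G | q.2 * q.1 * q.2⁻¹ ∈ A}) :=
    measurable_measure_prodMk_left (measurableSet_conjSet hA)
  have hfun : (fun U : G => haarProbability G {g : G | g * U * g⁻¹ ∈ A}) = fun U : G =>
      haarProbability G (Prod.mk U ⁻¹' {q : G × G | q.2 * q.1 * q.2⁻¹ ∈ A}) := by
    funext U
    rw [Set.preimage_setOf_eq]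
  rw [hfun]
  exact h

omit [SecondCountableTopology G] in
/-- **`κ_A` is a class function**: `κ_A(h U h⁻¹) = κ_A(U)` (right invariance of Haar:
`g (hUh⁻¹) g⁻¹ = (gh) U (gh)⁻¹`). -/
theorem conjMass_conj {A : Set G} (hA : MeasurableSet A) (U h : G) :
    haarProbability G {g : G | g * (h * U * h⁻¹) * g⁻¹ ∈ A} =
      haarProbability G {g : G | g * U * g⁻¹ ∈ A} := by
  have hB : MeasurableSet {g : G | g * U * g⁻¹ ∈ A} :=
    (((continuous_id.mul continuous_const).mul continuous_id.inv).measurable) hA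
  have hset : {g : G | g * (h * U * h⁻¹) * g⁻¹ ∈ A} = (fun g => g * h) ⁻¹' {g : G | g * U * g⁻¹ ∈ A} := by
    ext g
    simp only [Set.mem_setOf_eq, Set.mem_preimage, _root_.mul_inv_rev, mul_assoc]
  rw [hset, ← Measure.map_apply (measurable_mul_const h) hB, map_mul_right_eq_self]

omit [SecondCountableTopology G] in
/-- **Conjugation invariance of Haar**: `Haar{U | g U g⁻¹ ∈ A} = Haar(A)`. -/
theorem haar_conjPreimage {A : Set G} (hA : MeasurableSet A) (g : G) :
    haarProbability G {U : G | g * U * g⁻¹ ∈ A} = haarProbability G A := by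
  have hset : {U : G | g * U * g⁻¹ ∈ A} = (fun U => U * g⁻¹) ⁻¹' ((fun U => g * U) ⁻¹' A) := by
    ext U; simp only [Set.mem_setOf_eq, Set.mem_preimage, mul_assoc]
  rw [hset, ← Measure.map_apply (measurable_mul_const g⁻¹) ((measurable_const_mul g) hA),
    map_mul_right_eq_self, ← Measure.map_apply (measurable_const_mul g) hA, map_mul_left_eq_self]

/-- **`Haar(A) = ∫ κ_A(U) dHaar(U)`** (Tonelli on `{(U, g) | g U g⁻¹ ∈ A}` and conjugation
invariance). -/
theorem haar_eq_lintegral_conjMass {A : Set G} (hA : MeasurableSet A) :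
    haarProbability G A = ∫⁻ U, haarProbability G {g : G | g * U * g⁻¹ ∈ A} ∂(haarProbability G) := by
  have hS := measurableSet_conjSet (G := G) hA
  have h1 : ((haarProbability G).prod (haarProbability G)) {q : G × G | q.2 * q.1 * q.2⁻¹ ∈ A} =
      ∫⁻ U, haarProbability G {g : G | g * U * g⁻¹ ∈ A} ∂(haarProbability G) :=
    Measure.prod_apply hS
  have h2 : ((haarProbability G).prod (haarProbability G)) {q : G × G | q.2 * q.1 * q.2⁻¹ ∈ A} =
      ∫⁻ g, haarProbability G {U : G | g * U * g⁻¹ ∈ A} ∂(haarProbability G) :=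
    Measure.prod_apply_symm hS
  rw [← h1, h2]
  simp_rw [haar_conjPreimage hA]
  rw [lintegral_const, measure_univ, mul_one]

end ConjMass

end Summit.Ventures.LatticeQCDFlow.Exactness
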